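import Literature.NumberTheory.Rogawski1990.FinExplicitTransferFactor
import HarnessLib

/-!
# `Δ‴_v(x γ_H x⁻¹, γ′) = Δ‴_v(γ_H, γ′)`: Rogawski's explicit finite-place transfer factor is a class function of `γ_H ∈ H_v` (node N1f-l of `F0/P3a/T6b-TREE.md`;
# the hypothesis `hl` of ★ `finExplicitTransferFactor` ∕ `finExplicitCollection` DISCHARGED)

Topic `NumberTheory/Rogawski1990`; namespace `Literature.NumberTheory.Rogawski1990`.  THEOREMS ONLY (no definition, no named fact, no instance, no notation, no `sorry`).
Cell `pub/hodgecm-mathlib`, floor 0, F0∕P3a, crux H413, typer topic T6 (#72 side, DESK TABLE #3 row (1)); the finite-place twin of ★ `archExplicitDelta_conj_left` (N1a-l,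
`ArchExplicitTransferFactor` ED. 2 §7, p826446), token-parallel.

For `γ_H = (g, u) ∈ H_v = U(Φ₂)(L⁺_v) × U(Φ₁)(L⁺_v)` and `x ∈ H_v`, every ingredient of ★ `finExplicitDelta L v H′ γ_H μ γ′` (★ `FinExplicitTransferFactor`, p827456) is a
class function of `γ_H`: `γ₂ = u` (`U(Φ₁)` is a `1 × 1` matrix group, `finGammaTwo_conj`), `χ_g` (`Matrix.charpoly_units_conj`, `finCharpolyTwo_conj`), `det g⁻¹`
(`finDetInvFst_conj`), hence `τ_v` (`finTauArg_conj`, `finTau_conj`) and `D_{G∕H,v}` (`finWeylRatio_conj`); the projector `P_v = χ_g(γ′) = γ′² − tr g·γ′ + det g` reads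
`g` only through `tr g`, `det g` (`finEigenlineProjector_conj`), so the column form values, the relative position `x_v` and the sign `κ_v` are unchanged
(`finColumnFormValue_conj`, `finRelPos_conj`, `finKappaAt_conj_left`); matching `ι_v(γ_H) ↔ γ′` only sees the stable class of `γ_H` (`isLocalNormPair_conj_left`, `ι_v` a
homomorphism).  Main: **`finExplicitDelta_conj_left L v H′ μ : ∀ a b x, finExplicitDelta L v H′ (x * a * x⁻¹) μ b = finExplicitDelta L v H′ a μ b`** — the TYPE of the
binder `hl` of ★ `finExplicitTransferFactor L v H′ μ hl hr` token for token — and the all-places form **`finExplicitDelta_conj_left_all L H′ μ`** = the binder `hl` of ★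
`finExplicitCollection L H′ μ hl hr`.  Print: «Δ_{G∕H}(γ) … for `G`-regular elements `γ` in `H`» is a function of (stable) conjugacy classes (§4.3 p. 43: the factor is
defined on classes; §4.9 p. 55 the explicit `τ · D_{G∕H}`; [LanglandsShelstad1987, §1]: `Δ(γ_H, γ_G)` depends only on the conjugacy classes).
HONEST LABEL: HC_CM is proved only modulo the printed citations until rung 0 closes; this file removes one hypothesis binder from the explicit #72 collection, nothing more.

## References
* [Rogawski1990] J. D. Rogawski, *Automorphic Representations of Unitary Groups in Three Variables*, Ann. of Math. Stud. 123 (1990), §4.3 p. 43, §4.9 p. 55, §14.1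
  p. 232, §14.6 p. 242.
* [LanglandsShelstad1987] R. P. Langlands, D. Shelstad, *On the definition of transfer factors*, Math. Ann. 278 (1987), §1 (transfer factors as functions of classes).
-/

set_option autoImplicit false

noncomputable section

open NumberField IsDedekindDomain Matrix Polynomial
open Literature.NumberTheory.GaloisRepresentations
open scoped MatrixGroups

namespace Literature.NumberTheory.Rogawski1990

open Literature.NumberTheory.Automorphic

variable (L : Type) [Field L] [NumberField L] (v : HeightOneSpectrum (𝓞 ↥(maximalRealSubfield L)))

/-! ## N1f-l: invariance of `Δ‴_v` under `H_v`-conjugation of `γ_H` — the hypothesis `hl` of ★ `finExplicitTransferFactor` DISCHARGED -/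

section ConjLeft

variable [IsCMField L] (H' : Matrix (Fin 3) (Fin 3) L)
  (a x : (UnitaryGroup.cmDatum L 2 (Matrix.of fun i j : Fin 2 => if i.val + j.val + 1 = 2 then (1 : L) else 0)).Local v ×
      (UnitaryGroup.cmDatum L 1 (Matrix.of fun i j : Fin 1 => if i.val + j.val + 1 = 1 then (1 : L) else 0)).Local v)

/-- `γ₂` is a class function on `H_v` (the `U(Φ₁)`-coordinate is a `1 × 1` matrix group: `γ₂ = det`). [cite: Rogawski1990, §4.9 p. 55] -/
theorem finGammaTwo_conj : finGammaTwo L v (x * a * x⁻¹) = finGammaTwo L v a := by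
  have h : ((x * a * x⁻¹).2.val : GL (Fin 1) (UnitaryGroup.LocalRing L v)) =
      (x.2.val : GL (Fin 1) (UnitaryGroup.LocalRing L v)) * (a.2.val : GL (Fin 1) (UnitaryGroup.LocalRing L v)) *
        (x.2.val : GL (Fin 1) (UnitaryGroup.LocalRing L v))⁻¹ := by
    simp only [Prod.snd_mul, Prod.snd_inv]
    rfl
  unfold finGammaTwo
  rw [h, Units.val_mul, Units.val_mul]
  have e1 := Matrix.det_fin_one ((x.2.val : GL (Fin 1) (UnitaryGroup.LocalRing L v)).val * (a.2.val : GL (Fin 1) (UnitaryGroup.LocalRing L v)).val *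
    ((x.2.val : GL (Fin 1) (UnitaryGroup.LocalRing L v))⁻¹).val)
  have e2 := Matrix.det_fin_one ((a.2.val : GL (Fin 1) (UnitaryGroup.LocalRing L v)).val)
  rw [← e1, ← e2, Matrix.det_units_conj]

/-- `χ_g` is a class function on `H_v`. [cite: Rogawski1990, §4.9 p. 55] -/
theorem finCharpolyTwo_conj : finCharpolyTwo L v (x * a * x⁻¹) = finCharpolyTwo L v a := by
  unfold finCharpolyTwo
  have h : ((x * a * x⁻¹).1.val : GL (Fin 2) (UnitaryGroup.LocalRing L v)) =
      (x.1.val : GL (Fin 2) (UnitaryGroup.LocalRing L v)) * (a.1.val : GL (Fin 2) (UnitaryGroup.LocalRing L v)) *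
        (x.1.val : GL (Fin 2) (UnitaryGroup.LocalRing L v))⁻¹ := by
    simp only [Prod.fst_mul, Prod.fst_inv]
    rfl
  rw [h, Units.val_mul, Units.val_mul, Matrix.coe_units_inv, Matrix.charpoly_units_conj]

/-- `det g⁻¹` is a class function on `H_v`. [cite: Rogawski1990, §4.9 p. 55] -/
theorem finDetInvFst_conj :
    ((((x * a * x⁻¹).1.val : GL (Fin 2) (UnitaryGroup.LocalRing L v))⁻¹ : GL (Fin 2) (UnitaryGroup.LocalRing L v)) : Matrix (Fin 2) (Fin 2) (UnitaryGroup.LocalRing L v)).det =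
      (((a.1.val⁻¹ : GL (Fin 2) (UnitaryGroup.LocalRing L v)) : Matrix (Fin 2) (Fin 2) (UnitaryGroup.LocalRing L v))).det := by
  have h : (((x * a * x⁻¹).1.val : GL (Fin 2) (UnitaryGroup.LocalRing L v))⁻¹ : GL (Fin 2) (UnitaryGroup.LocalRing L v)) =
      (x.1.val : GL (Fin 2) (UnitaryGroup.LocalRing L v)) * ((a.1.val : GL (Fin 2) (UnitaryGroup.LocalRing L v))⁻¹) *
        (x.1.val : GL (Fin 2) (UnitaryGroup.LocalRing L v))⁻¹ := by
    have h0 : ((x * a * x⁻¹).1.val : GL (Fin 2) (UnitaryGroup.LocalRing L v)) =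
        (x.1.val : GL (Fin 2) (UnitaryGroup.LocalRing L v)) * (a.1.val : GL (Fin 2) (UnitaryGroup.LocalRing L v)) *
          (x.1.val : GL (Fin 2) (UnitaryGroup.LocalRing L v))⁻¹ := by
      simp only [Prod.fst_mul, Prod.fst_inv]
      rfl
    rw [h0, _root_.mul_inv_rev, _root_.mul_inv_rev, inv_inv, mul_assoc]
  rw [h, Units.val_mul, Units.val_mul, Matrix.det_units_conj]

/-- `τ_v`'s argument `−χ_g(γ₂)·det g⁻¹` is a class function on `H_v`. [cite: Rogawski1990, §4.9 p. 55] -/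
theorem finTauArg_conj : finTauArg L v (x * a * x⁻¹) = finTauArg L v a := by
  unfold finTauArg
  rw [finCharpolyTwo_conj, finGammaTwo_conj, finDetInvFst_conj]

/-- `τ_v` is a class function on `H_v`. [cite: Rogawski1990, §4.9 p. 55] -/
theorem finTau_conj (μ : HeckeCharacter L) : finTau L v (x * a * x⁻¹) μ = finTau L v a μ := by
  unfold finTau
  rw [finGammaTwo_conj, finTauArg_conj]

/-- `D_{G∕H,v}` is a class function on `H_v`. [cite: Rogawski1990, §4.9 p. 55] -/
theorem finWeylRatio_conj : finWeylRatio L v (x * a * x⁻¹) = finWeylRatio L v a := by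
  unfold finWeylRatio
  rw [finCharpolyTwo_conj, finGammaTwo_conj]

/-- `P_v = χ_g(γ′)` depends on `γ_H` only through `tr g`, `det g` — class functions. [cite: Rogawski1990, §4.9 p. 55; §14.6 p. 242] -/
theorem finEigenlineProjector_conj (γ' : (UnitaryGroup.cmDatum L 3 H').Local v) :
    finEigenlineProjector L v H' (x * a * x⁻¹) γ' = finEigenlineProjector L v H' a γ' := by
  have hc := finCharpolyTwo_conj L v a x
  unfold finCharpolyTwo at hc
  have htr := congrArg (fun p : Polynomial (UnitaryGroup.LocalRing L v) => -p.coeff (Fintype.card (Fin 2) - 1)) hc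
  have hdet := congrArg (fun p : Polynomial (UnitaryGroup.LocalRing L v) => (-1 : UnitaryGroup.LocalRing L v) ^ Fintype.card (Fin 2) * p.coeff 0) hc
  simp only [← Matrix.trace_eq_neg_charpoly_coeff, ← Matrix.det_eq_sign_charpoly_coeff] at htr hdet
  unfold finEigenlineProjector
  simp only [htr, hdet]

/-- The column form values `x_j = p_jᴴ H′_v p_j` are class functions of `γ_H`. [cite: Rogawski1990, §3.5 Prop. 3.5.2 (c) p. 29; §4.9 p. 55] -/
theorem finColumnFormValue_conj (γ' : (UnitaryGroup.cmDatum L 3 H').Local v) (j : Fin 3) :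
    finColumnFormValue L v H' (x * a * x⁻¹) γ' j = finColumnFormValue L v H' a γ' j := by
  unfold finColumnFormValue
  rw [finEigenlineProjector_conj]

open scoped Classical in
/-- The relative position `x_v(γ_H, γ′)` is a class function of `γ_H`. [cite: Rogawski1990, §4.3 p. 43] [cite: LanglandsShelstad1987, §1] -/
theorem finRelPos_conj (γ' : (UnitaryGroup.cmDatum L 3 H').Local v) :
    finRelPos L v H' (x * a * x⁻¹) γ' = finRelPos L v H' a γ' := by
  unfold finRelPos
  simp only [finEigenlineProjector_conj, finColumnFormValue_conj]

open scoped Classical in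
/-- `κ_v` is a class function of `γ_H`. [cite: Rogawski1990, §14.6 p. 242; §4.3 p. 43] -/
theorem finKappaAt_conj_left (γ' : (UnitaryGroup.cmDatum L 3 H').Local v) :
    finKappaAt L v H' (x * a * x⁻¹) γ' = finKappaAt L v H' a γ' := by
  unfold finKappaAt
  rw [finEigenlineProjector_conj, finRelPos_conj]

/-- `ι_v(xγ_Hx⁻¹) ↔ γ′` iff `ι_v(γ_H) ↔ γ′` (matching only sees the stable class of `γ_H`). [cite: Rogawski1990, §14.1 p. 232] -/
theorem isLocalNormPair_conj_left (γ' : (UnitaryGroup.cmDatum L 3 H').Local v) :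
    IsLocalNormPair L H' v (x * a * x⁻¹) γ' ↔ IsLocalNormPair L H' v a γ' := by
  rw [isLocalNormPair_iff, isLocalNormPair_iff, map_mul, map_mul, map_inv]
  have hst : IsStablyConj (UnitaryGroup.conjLocal L (IsCMField.complexConj L) v)
      ((UnitaryGroup.adelicForm L 3 (Matrix.of fun i j : Fin 3 => if i.val + j.val + 1 = 3 then (1 : L) else 0)).map (UnitaryGroup.adeleToLocal L v))
      (endoEmbLocal L v a) (endoEmbLocal L v x * endoEmbLocal L v a * (endoEmbLocal L v x)⁻¹) :=
    isStablyConj_of_isConj (isConj_iff.2 ⟨endoEmbLocal L v x, rfl⟩)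
  exact ⟨fun h => h.of_isStablyConj_left hst.symm, fun h => h.of_isStablyConj_left hst⟩

open scoped Classical in
/-- **N1f-l: `Δ‴_v(xγ_Hx⁻¹, γ′) = Δ‴_v(γ_H, γ′)`** — invariance under conjugation of `γ_H` in `H_v` (the `conj_left` field of ★ `TransferFactorData`, so
`finExplicitTransferFactor L v H′ μ (finExplicitDelta_conj_left L v H′ μ) hr` needs only `hr`).  Print: the transfer factor depends only on the (stable) conjugacy
classes of its arguments. [cite: Rogawski1990, §4.9 p. 55; §4.3 p. 43] [cite: LanglandsShelstad1987, §1] -/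
theorem finExplicitDelta_conj_left (μ : HeckeCharacter L) :
    ∀ (a : (UnitaryGroup.cmDatum L 2 (Matrix.of fun i j : Fin 2 => if i.val + j.val + 1 = 2 then (1 : L) else 0)).Local v ×
          (UnitaryGroup.cmDatum L 1 (Matrix.of fun i j : Fin 1 => if i.val + j.val + 1 = 1 then (1 : L) else 0)).Local v)
      (b : (UnitaryGroup.cmDatum L 3 H').Local v)
      (x : (UnitaryGroup.cmDatum L 2 (Matrix.of fun i j : Fin 2 => if i.val + j.val + 1 = 2 then (1 : L) else 0)).Local v ×
          (UnitaryGroup.cmDatum L 1 (Matrix.of fun i j : Fin 1 => if i.val + j.val + 1 = 1 then (1 : L) else 0)).Local v),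
      finExplicitDelta L v H' (x * a * x⁻¹) μ b = finExplicitDelta L v H' a μ b := by
  intro a b x
  by_cases h : IsLocalNormPair L H' v a b
  · rw [finExplicitDelta_of_isLocalNormPair L v H' _ μ ((isLocalNormPair_conj_left L v H' a x b).2 h),
      finExplicitDelta_of_isLocalNormPair L v H' _ μ h, finTau_conj, finWeylRatio_conj]
    simp only [finKappaAt_conj_left]
  · rw [finExplicitDelta_of_not_isLocalNormPair L v H' _ μ (fun h' => h ((isLocalNormPair_conj_left L v H' a x b).1 h')),
      finExplicitDelta_of_not_isLocalNormPair L v H' _ μ h]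

/-- The collection form: `hl` of ★ `finExplicitCollection` at every finite place. [cite: Rogawski1990, §4.9 p. 55; §14.6 p. 242] -/
theorem finExplicitDelta_conj_left_all (μ : HeckeCharacter L) :
    ∀ (v : HeightOneSpectrum (𝓞 ↥(maximalRealSubfield L)))
      (a : (UnitaryGroup.cmDatum L 2 (Matrix.of fun i j : Fin 2 => if i.val + j.val + 1 = 2 then (1 : L) else 0)).Local v ×
          (UnitaryGroup.cmDatum L 1 (Matrix.of fun i j : Fin 1 => if i.val + j.val + 1 = 1 then (1 : L) else 0)).Local v)
      (b : (UnitaryGroup.cmDatum L 3 H').Local v)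
      (x : (UnitaryGroup.cmDatum L 2 (Matrix.of fun i j : Fin 2 => if i.val + j.val + 1 = 2 then (1 : L) else 0)).Local v ×
          (UnitaryGroup.cmDatum L 1 (Matrix.of fun i j : Fin 1 => if i.val + j.val + 1 = 1 then (1 : L) else 0)).Local v),
      finExplicitDelta L v H' (x * a * x⁻¹) μ b = finExplicitDelta L v H' a μ b :=
  fun v => finExplicitDelta_conj_left L v H' μ

end ConjLeft

end Literature.NumberTheory.Rogawski1990

end
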